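import Summits.MatrixMultiplication.MatrixMultiplication.Theses.StrassenDefect
import Literature.Computability.AlgebraicComplexity.AsymptoticSpectrumDuality
import Literature.Computability.AlgebraicComplexity.AsymptoticRankMatMul
import Literature.Computability.AlgebraicComplexity.AsymptoticRankMultiplesMatMul
import Literature.Barriers.MatrixMultiplication.UniversalMethodBarrierAsymptoticRank

/-!
# MatrixMultiplication / StrassenDefect — the defect inequality `(mN)^ω ≤ m²·N^ω + R̃(J)`

Route `MatrixMultiplication/StrassenDefect`, support item `stmt-MatrixMultiplication-4077`
(`DefectInequality`): if `(⟨m²⟩ ⊗ ⟨N,N,N⟩) ⊕ J ⊵ ⟨mN,mN,mN⟩` (a polynomial degeneration,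
`PolyDegeneratesTo`) with `m, N ≥ 1`, then `(mN)^ω ≤ m²·N^ω + R̃(J)`.

One line of Strassen calculus, assembled from the cone already in the tree:

* `R̃` is monotone under degeneration (`asymptoticRank_le_of_polyDegeneratesTo`), so
  `R̃(⟨mN,mN,mN⟩) ≤ R̃((⟨m²⟩ ⊗ ⟨N,N,N⟩) ⊕ J)`;
* `R̃` is subadditive under direct sum (`asymptoticRank_directSumTensor_le_add` below, from
  Strassen duality `strassen_duality_asymptoticRank_holds`: a universal spectral point `F` with
  `F(s ⊕ t) = R̃(s ⊕ t)` is additive and bounded by `R̃` on each summand);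
* `R̃(⟨q,q,q⟩) = q^ω` (`asymptoticRank_matMulTensor`) and `R̃(⟨t⟩ ⊗ ⟨q,q,q⟩) = t·q^ω`
  (`asymptoticRank_multiple_matMulTensor_cube`).

Theorems only, no definitions.
-/

-- `Summit.<Summit>.<Problem>` is the tree's mandated summit-side namespace; for this
-- single-conjunct summit the two coincide, so the file silences `dupNamespace`.
set_option linter.dupNamespace false

noncomputable section

open Literature.Computability.AlgebraicComplexity
open Literature.Barriers.MatrixMultiplication

namespace Summit.MatrixMultiplication.MatrixMultiplication.Theorems

/-- **Subadditivity of the asymptotic rank under direct sum**, `R̃(s ⊕ t) ≤ R̃(s) + R̃(t)`, for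
3-tensors over a field with finite index types: by Strassen duality
(`strassen_duality_asymptoticRank_holds`) some universal spectral point `F` attains
`F(s ⊕ t) = R̃(s ⊕ t)`, and `F(s ⊕ t) = F(s) + F(t) ≤ R̃(s) + R̃(t)`. -/
theorem asymptoticRank_directSumTensor_le_add {K : Type} [Field K] {ι κ μ ι' κ' μ' : Type}
    [Fintype ι] [Fintype κ] [Fintype μ] [Fintype ι'] [Fintype κ'] [Fintype μ']
    (s : ι → κ → μ → K) (t : ι' → κ' → μ' → K) :
    asymptoticRank (directSumTensor s t) ≤ asymptoticRank s + asymptoticRank t := by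
  have hdual : strassen_duality_asymptoticRank K := strassen_duality_asymptoticRank_holds K
  refine hdual.asymptoticRank_le (directSumTensor s t) fun F hF => ?_
  rw [hF.map_directSum s t]
  exact add_le_add ((hdual s).1 F hF) ((hdual t).1 F hF)

/-- **The defect inequality** (item `stmt-MatrixMultiplication-4077`): if
`(⟨m²⟩ ⊗ ⟨N,N,N⟩) ⊕ J ⊵ ⟨mN,mN,mN⟩` with `m, N ≥ 1`, then `(mN)^ω ≤ m²·N^ω + R̃(J)`
(`R̃(⟨mN⟩) = (mN)^ω`, monotonicity of `R̃` under degeneration, subadditivity under `⊕`, and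
`R̃(⟨m²⟩ ⊗ ⟨N⟩) = m²·N^ω`). -/
theorem DefectInequality_proof :
    Summit.MatrixMultiplication.MatrixMultiplication.Theses.StrassenDefect.DefectInequality := by
  unfold Summit.MatrixMultiplication.MatrixMultiplication.Theses.StrassenDefect.DefectInequality
  intro m N a b c hm hN J hdeg
  have hmN : 1 ≤ m * N := Nat.one_le_iff_ne_zero.2 (Nat.mul_ne_zero (by omega) (by omega))
  have hm2 : 1 ≤ m ^ 2 := Nat.one_le_pow _ _ hm
  -- `R̃(⟨mN,mN,mN⟩) = (mN)^ω`
  have h1 : ((m : ℝ) * N) ^ omega ℂ = asymptoticRank (matMulTensor ℂ (m * N) (m * N) (m * N)) := by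
    rw [asymptoticRank_matMulTensor ℂ (m * N) hmN]
    push_cast
    rfl
  -- monotonicity under degeneration
  have h2 : asymptoticRank (matMulTensor ℂ (m * N) (m * N) (m * N)) ≤
      asymptoticRank (directSumTensor (kroneckerTensor (unitTensor ℂ (m ^ 2))
        (matMulTensor ℂ N N N)) J) :=
    asymptoticRank_le_of_polyDegeneratesTo hdeg
  -- subadditivity
  have h3 : asymptoticRank (directSumTensor (kroneckerTensor (unitTensor ℂ (m ^ 2))
        (matMulTensor ℂ N N N)) J) ≤
      asymptoticRank (kroneckerTensor (unitTensor ℂ (m ^ 2)) (matMulTensor ℂ N N N)) +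
        asymptoticRank J :=
    asymptoticRank_directSumTensor_le_add _ _
  -- `R̃(⟨m²⟩ ⊗ ⟨N,N,N⟩) = m²·N^ω`
  have h4 : asymptoticRank (kroneckerTensor (unitTensor ℂ (m ^ 2)) (matMulTensor ℂ N N N)) =
      (m : ℝ) ^ 2 * (N : ℝ) ^ omega ℂ := by
    rw [asymptoticRank_multiple_matMulTensor_cube ℂ hN hm2]
    push_cast
    rfl
  calc ((m : ℝ) * N) ^ omega ℂ
      = asymptoticRank (matMulTensor ℂ (m * N) (m * N) (m * N)) := h1
    _ ≤ asymptoticRank (directSumTensor (kroneckerTensor (unitTensor ℂ (m ^ 2))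
          (matMulTensor ℂ N N N)) J) := h2
    _ ≤ asymptoticRank (kroneckerTensor (unitTensor ℂ (m ^ 2)) (matMulTensor ℂ N N N)) +
          asymptoticRank J := h3
    _ = (m : ℝ) ^ 2 * (N : ℝ) ^ omega ℂ + asymptoticRank J := by rw [h4]

end Summit.MatrixMultiplication.MatrixMultiplication.Theorems

end
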